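import Literature.MathematicalPhysics.QuantumFieldTheory.Balaban1983to89.B13JointWalkExpansionSymmetrize

/-!
# `Balaban1983to89.B13EntrywiseWalks` — T. Bałaban, *Renormalization group approach to lattice gauge field theories. II.
Cluster expansions*, Commun. Math. Phys. **116** (1988) 1–22 [Balaban1988RG2Cluster], p. 3 (after (1.7): the
`s`-decoration of a random-walk expansion), (1.11) p. 5, p. 13, (2.5) p. 12, p. 15; [13] = *Propagators for lattice gauge
theories in a background field*, Commun. Math. Phys. **99** (1985) 389–434 [Balaban1985BackgroundPropagators], (3.93)
p. 410, Thm 3.10 (3.107)–(3.108) p. 416: THE ENTRYWISE PACKAGING — a kernel family `Δ₀(u)` with ENTRYWISE (3.108)-type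
decay `‖Δ₀(u)_{ij}‖ ≤ Be^{−ρd₁(i,j)}` and entrywise holomorphy on the complex `R`-ball is its own σ-free joint walk
expansion (`B13JointWalkExpansion.JointWalkExpansion`: one «walk» per matrix entry), and with ONE geometric letter on a
cube decoration (`|J(i,j)| ≤ c₀ + d₁(i,j)∕M₁`, a decorated entry's locations joined by a `d₁`-geodesic through `X`) every
walk-side binder of the N10 junction's structured datum (`B13ConditioningDecoration` §2–§3,
`B13JointWalkExpansionSymmetrize` §3) is discharged — the walk indexing is free at the junction; what the (2.14)∕(2.26)
machinery consumes of [13] Thm 3.10 is the entrywise decay + holomorphy of the FINAL operator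

statement-level bookkeeping over published theorems with citation tags; kernel-checked; model `def`s with bodies and
Prop-valued hypothesis shapes; nothing here is a claim about the Yang–Mills mass gap.

PROVENANCE.  PORT (cell `pub-ymgap`, D-0062 Track A, node N10 = [B13]; seat `pub-ymgap-dag-n10-c` g4, module 31) of
cell `ym-nodeO-ideate`'s ROUTE-P2 companion 19 `pub/ym-nodeO-ideate/memos/ROUTE-P2-files/SketchEntrywiseJWE.lean`
(seat P2 g30, memo `ROUTE-P2.md` v3.38 §S56; sha256 f4ef3d8de64b6f01f28f146c81c80bbbc29c9375ed670a45e313dbfe2f3def23;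
farm rc 0, 0 warnings, std axioms there), on P2's standing offer («a tree port of T-56.7 ∕ T-56.8 is yours to ask or do,
with provenance, as with companion 17 → module 20», bus 2026-08-27T05:08Z): declarations BYTE-IDENTICAL to the companion
except (i) the namespace `YM.NodeO.P2.EntrywiseJWE` → this Literature namespace, (ii) this header, (iii) ten helper docstrings whose
`[folklore]` ∕ missing tag is replaced by a `[cite:]` locator (Literature lint; statements and proofs untouched).  The
companion's own module docstring follows verbatim between the rules.

────────────────────────────────────────────────────────────────────────────────────────────────────────────────────────
# `SketchEntrywiseJWE` — ROUTE-P2 companion 19 (cell `ym-nodeO-ideate`, seat P2 g30, memo v3.38 §S56)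

T. Bałaban, *Renormalization group approach to lattice gauge field theories. II. Cluster expansions*, Commun. Math.
Phys. **116** (1988) 1–22 [Balaban1988RG2Cluster], p. 3 (after (1.7): the `s`-decoration of a random-walk expansion),
(1.11) p. 5, p. 13, (2.5) p. 12, p. 15; [13] = *Propagators for lattice gauge theories in a background field*, Commun. Math.
Phys. **99** (1985) 389–434 [Balaban1985BackgroundPropagators], (3.93) p. 410, Thm 3.10 (3.107)–(3.108) p. 416.

MEMO-SIDE SKETCH, NOT A TREE FILE (the walk-free interface one level down).  The landed module 24
`B13ConditioningDecoration` (pub-ymgap dag-n10-c g3, p490407) reduces the expansion binder `hKexp` of the N10 record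
junction (`Summits/…/BalabanUVNodesN10AtRecord11B13WalksBlockMonomialHolo`, module 21) for `K = Cᵀ·Δ(s,·)·C` to ONE
σ-FREE joint walk expansion `h₀` of `Δ₀(u)` with a walk reversal (`rev`, `hrevT`), a cube decoration `J` compatible
with it (`hrevJ`), print's dichotomy (P1) `hdich`, restriction (P2) `hR1`, the through-clause `hX`, and (§3) walk
distances dominating `d₁` (`hdom`).  THIS FILE RECORDS THAT ALL OF THESE ARE INHABITED BY ENTRYWISE LETTERS OF `Δ₀`:
* §1 the ENTRYWISE PACKAGING — walks `W = p × p` (one «walk» per matrix entry), terms `T_{(i,j)}(u)` = the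
  symmetrised entry `½(Δ₀(u)_{ij} + Δ₀(u)_{ji})` placed at `(i,j)`, amplitudes `A ≡ B`, walk distances
  `D_{(i,j)}(a,b) = d₁(a,b)` at the entry's own pair of locations and `D_X(a,b) + L` elsewhere ((3.93): a walk's distance
  between points that are not its ends is as large as we please — the term vanishes there), `SX = ∅`, rate `ρ`;
* §2 `jointWalkExpansion_entrywise` — THREE LETTERS of `Δ₀` on the complex `R`-ball (entrywise decay
  `‖Δ₀(u)_{ij}‖ ≤ B e^{−ρ d₁(i,j)}`, entrywise holomorphy, symmetry `Δ₀(u)ᵀ = Δ₀(u)`) + a fibre bound `m_F` of the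
  locations ⟹ the packaging IS a σ-free `JointWalkExpansion` through any non-empty `X` at `(R, ε, κ ≤ ρ − ε, B(m_F²+1))`
  for every drop `ε < ρ`, once `L ≥ |p|²∕(ρ − ε)`;
* §3 `structuredExpansion_entrywise` ∕ `structuredExpansion_sandwich_entrywise` (+ the one-cube instance
  `geodesicDecoration_oneCube` of the geometric letter: non-vacuity) — with the reversal `(i,j) ↦ (j,i)`
  (`Equiv.prodComm`) and ONE GEOMETRIC LETTER on a decoration `J : p × p → Finset (cubes)` (symmetric; cube count
  `|J(i,j)| ≤ c₀ + d₁(i,j)∕M₁`; a decorated entry's pair of locations is joined by a `d₁`-geodesic THROUGH `X`) and the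
  numerics `0 < η ≤ ε < ρ`, `2κ₁ ≤ ηM₁` (print's restriction `δ₁M ≥ κ₁` in this currency): EVERY hypothesis of module 24's
  `structuredExpansion_sDecorate` (§2) and `structuredExpansion_sandwich_sDecorate` (§3) is discharged — kernel-checked
  APPLICATIONS of the landed theorems, conclusions literally theirs (`m₀ = 2c₀`, `δ₁M = ρM₁∕2`);
* §4 `sDecorate_entryTerm_apply` — WHAT THE RESULTING CONDITIONED OPERATOR IS: the HADAMARD (entrywise) product
  `Δ(s,u)_{ab} = (∏_{□ ∈ J(a,b)} s(□))·½(Δ₀(u)_{ab} + Δ₀(u)_{ba})` — NOT Bałaban's walk-decorated `Δ_k(σ)` of p. 3 but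
  another conditioning with the properties the tree's junction asks; and `structuredExpansion_undecorated` — the
  VACUITY FLAG: the trivial decoration `J ≡ ∅` (no `s`-dependence at all) meets module 24's hypotheses too (at every drop `0 < η ≤ ε`),
  so the decoupling PURPOSE of (1.11) (`s(□) = 0` ⇒ no coupling across `□`) is not encoded in `hKexp`'s clauses — it can
  only enter the DAG through the dictionary binder `hT₃` ∕ the record's `T₃` (located audit question, not a defect claim);
  `sDecorate_entryTerm_eq_zero` ∕ `sDecorate_entryTerm_one` — what the Hadamard conditioning DOES encode: an entry
  charged a killed cube vanishes, and at `s ≡ 1` the conditioned operator is the (symmetrised) `Δ₀`;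
* §5 (after module 25 `B13JointWalkExpansionSymmetrize`, pub-ymgap dag-n10-c g4, p494535 — landed while this file was
  being written — which manufactures the walk reversal by SYMMETRIZING any σ-free expansion, `½T_ω ⊕ ½T_ωᵀ`)
  `jointWalkExpansion_rawEntrywise` ∕ `structuredExpansion_sandwich_rawEntrywise` — THE SYMMETRY LETTER LEAVES THE
  ASK: TWO entrywise letters (decay, holomorphy) + the fibre bound + the geometric letter + the same numerics ⟹ the
  junction's `hKexp` datum for module 25's conditioned operator (the decorated symmetrization of the RAW packaging
  `T_{(i,j)} = Δ₀(u)_{ij}`), which `sDecorate_symmetrize_rawEntryTerm` identifies, for a symmetric decoration, with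
  §4's Hadamard form entry by entry — so symmetry of `Δ₀(u)` at COMPLEX `u` (dag-ref-B's advisory READ-472 on module
  18's `hKsym`: print asserts symmetry on the real slice `(U′,0)` only, p. 15) is load-bearing ONLY for re-summing the
  symmetrised packaging of §2 to `Δ₀` itself (negative control NC19: delete `EntryLetters.symm` ⟹ exactly `hasSum` of
  §2 fails).

HONEST SCOPE.  Bookkeeping over the tree's hypothesis SHAPES ([folklore]: single-entry matrices, a two-part finite sum,
the triangle inequality) and two APPLICATIONS of landed theorems; NOTHING of Bałaban's `Δ_k(𝐔,𝐉)` is constructed or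
asserted — whether HIS fluctuation operator has the three letters k-uniformly at complex backgrounds is door R ∕ row
(D4)'s open OBJECT-level content; the Hadamard conditioning is NOT claimed to be the right conditioning for the cluster
expansion IDENTITY (2.5)–(2.6) — only to inhabit the junction's typed residual (entrywise `s`-weakening of a covariance is
print's «pair of cubes» interpolation genre, which «does not preserve positivity in general» — V. Rivasseau, *From
Perturbative to Constructive Renormalization* (1991) §III.1 p. 150, with a 3×3 example; the junction asks accretivity
only at the reference point, module 21 `hKacc`); NOT NODE O (:353), NOT [B12] Thm 2, nothing continuum ∕ mass-gap ∕ Clay.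
No `sorry`; five model `def`s with bodies, three hypothesis-shape `structure`s (Prop), no instance, no notation, no axiom.
────────────────────────────────────────────────────────────────────────────────────────────────────────────────────────
-/

noncomputable section

namespace Literature.MathematicalPhysics.QuantumFieldTheory.Balaban1983to89.B13EntrywiseWalks

open Metric Set Finset
open scoped Matrix
open Literature.MathematicalPhysics.QuantumFieldTheory.Balaban1983to89
open Literature.MathematicalPhysics.QuantumFieldTheory.Balaban1983to89.B9SectDWalk
  (DomBy Through MajSumLe passDist passDist_le domBy_passDist through_passDist)
open Literature.MathematicalPhysics.QuantumFieldTheory.Balaban1983to89.B9Thm34Ext (toB6)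
open Literature.MathematicalPhysics.QuantumFieldTheory.Balaban1983to89.B9Thm37GlueTorus
  (torusGeom tdist1 tdist1_nonneg tdist1_comm tdist1_triangle htri_torusGeom)
open Literature.MathematicalPhysics.QuantumFieldTheory.Balaban1983to89.TreeLengthTorus (TPt)
open Literature.MathematicalPhysics.QuantumFieldTheory.Balaban1983to89.B5TorusCover (UT)
open Literature.MathematicalPhysics.QuantumFieldTheory.Balaban1983to89.B13JointWalkExpansion (JointWalkExpansion)
open Literature.MathematicalPhysics.QuantumFieldTheory.Balaban1983to89.B13Eq111SDecoupling
  (sTerm sDecorate sTerm_apply sDecorate_apply)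
open Literature.MathematicalPhysics.QuantumFieldTheory.Balaban1983to89.B13ConditioningDecoration
  (structuredExpansion_sDecorate structuredExpansion_sandwich_sDecorate)
open Literature.MathematicalPhysics.QuantumFieldTheory.Balaban1983to89.B13JointWalkExpansionSymmetrize
  (structuredExpansion_sandwich_sDecorate_symm)

variable {d N' : ℕ} {ν : ℕ} {Nf : Fin ν → ℕ} [∀ i, NeZero (Nf i)]
variable {E : Type*} [NormedAddCommGroup E] [NormedSpace ℂ E]
variable {p : Type} [Fintype p] [DecidableEq p]

/-! ## §1. The entrywise packaging -/

/-- MODEL.  The ENTRY TERM of the packaging: the symmetrised `(i,j)` entry of `Δ₀(u)` placed at `(i,j)` — a «walk of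
length one from `i` to `j`» in the currency of [13] (3.107). [cite: Balaban1985BackgroundPropagators, (3.107) p.416] -/
def entryTerm (Δ₀ : E → Matrix p p ℂ) (ω : p × p) (u : E) : Matrix p p ℂ :=
  fun a b => if a = ω.1 ∧ b = ω.2 then (Δ₀ u ω.1 ω.2 + Δ₀ u ω.2 ω.1) / 2 else 0

/-- MODEL.  The ENTRY WALK DISTANCE: `d₁` at the entry's own pair of locations, `D_X + L` at every other pair ((3.93):
the infimum over chains through the walk's cubes; off the walk's ends we may take it as large as we please, the term
being zero there). [cite: Balaban1985BackgroundPropagators, (3.93) p.410] -/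
def entryDist (loc : p → UT Nf) (X : Finset (UT Nf)) (hX : X.Nonempty) (L : ℝ) (ω : p × p) (a b : UT Nf) : ℝ :=
  if a = loc ω.1 ∧ b = loc ω.2 then tdist1 Nf a b
  else passDist (g := toB6 (torusGeom Nf 0 0 0) 0 True) X hX a b + L

/-- **THE THREE ENTRYWISE LETTERS of a σ-free kernel family `Δ₀(u)` on the complex `R`-ball** (named hypothesis shape):
entrywise exponential decay at rate `ρ` with constant `B ≥ 0`, entrywise holomorphy, symmetry.
[cite: Balaban1985BackgroundPropagators, Thm 3.10 (3.107)–(3.108) p.416; Balaban1988RG2Cluster, p.15] -/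
structure EntryLetters (Δ₀ : E → Matrix p p ℂ) (loc : p → UT Nf) (R ρ B : ℝ) : Prop where
  decay : ∀ u ∈ ball (0 : E) R, ∀ i j, ‖Δ₀ u i j‖ ≤ B * Real.exp (-(ρ * tdist1 Nf (loc i) (loc j)))
  holo : ∀ i j, DifferentiableOn ℂ (fun u => Δ₀ u i j) (ball (0 : E) R)
  symm : ∀ u ∈ ball (0 : E) R, ∀ i j, Δ₀ u i j = Δ₀ u j i
  B_nonneg : 0 ≤ B

section Lemmas

variable {Δ₀ : E → Matrix p p ℂ} {loc : p → UT Nf} {X : Finset (UT Nf)} {hX : X.Nonempty} {L : ℝ}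

omit [Fintype p] [NormedAddCommGroup E] [NormedSpace ℂ E] in
/-- The entry term at its own entry. [cite: Balaban1985BackgroundPropagators, (3.107) p.416] -/
theorem entryTerm_self (ω : p × p) (u : E) :
    entryTerm Δ₀ ω u ω.1 ω.2 = (Δ₀ u ω.1 ω.2 + Δ₀ u ω.2 ω.1) / 2 := if_pos ⟨rfl, rfl⟩

omit [Fintype p] [NormedAddCommGroup E] [NormedSpace ℂ E] in
/-- The entry term vanishes off its own entry. [cite: Balaban1985BackgroundPropagators, (3.107) p.416] -/
theorem entryTerm_of_ne {ω : p × p} {u : E} {a b : p} (h : ¬(a = ω.1 ∧ b = ω.2)) :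
    entryTerm Δ₀ ω u a b = 0 := if_neg h

omit [Fintype p] [NormedAddCommGroup E] [NormedSpace ℂ E] in
/-- **REVERSAL** ([13] (3.107): the reversed walk gives the transposed term): swapping the entry transposes the term —
identically, thanks to the symmetrisation. [cite: Balaban1985BackgroundPropagators, (3.107) p.416] -/
theorem entryTerm_swap (ω : p × p) (u : E) (a b : p) :
    entryTerm Δ₀ ((Equiv.prodComm p p) ω) u a b = entryTerm Δ₀ ω u b a := by
  simp only [Equiv.prodComm_apply, entryTerm, Prod.fst_swap, Prod.snd_swap]
  by_cases h : a = ω.2 ∧ b = ω.1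
  · rw [if_pos h, if_pos ⟨h.2, h.1⟩, add_comm]
  · rw [if_neg h, if_neg fun h' => h ⟨h'.2, h'.1⟩]

omit [Fintype p] [DecidableEq p] [NormedAddCommGroup E] [NormedSpace ℂ E] in
/-- The entry distance at the entry's own pair of locations is `d₁`. [cite: Balaban1985BackgroundPropagators, (3.93) p.410] -/
theorem entryDist_self (ω : p × p) :
    entryDist loc X hX L ω (loc ω.1) (loc ω.2) = tdist1 Nf (loc ω.1) (loc ω.2) := if_pos ⟨rfl, rfl⟩

omit [Fintype p] [DecidableEq p] [NormedAddCommGroup E] [NormedSpace ℂ E] in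
/-- Off the own pair the entry distance is at least `d₁ + L` (`D_X` dominates `d₁`, (2.54)). [cite: Balaban1984PropagatorsII, (2.54) p.233] -/
theorem tdist1_add_le_entryDist {ω : p × p} {a b : UT Nf} (h : ¬(a = loc ω.1 ∧ b = loc ω.2)) :
    tdist1 Nf a b + L ≤ entryDist loc X hX L ω a b := by
  have hD : entryDist loc X hX L ω a b = passDist (g := toB6 (torusGeom Nf 0 0 0) 0 True) X hX a b + L :=
    if_neg h
  have h1 : tdist1 Nf a b ≤ passDist (g := toB6 (torusGeom Nf 0 0 0) 0 True) X hX a b :=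
    domBy_passDist (htri_torusGeom 0 0 0 0 True) X hX a b
  rw [hD]
  exact add_le_add h1 le_rfl

omit [Fintype p] [DecidableEq p] [NormedAddCommGroup E] [NormedSpace ℂ E] in
/-- The entry distances DOMINATE `d₁` (`hdom` of module 24 §3) when `L ≥ 0`. [cite: Balaban1984PropagatorsII, (2.54) p.233] -/
theorem tdist1_le_entryDist (hL : 0 ≤ L) (ω : p × p) (a b : UT Nf) :
    tdist1 Nf a b ≤ entryDist loc X hX L ω a b := by
  by_cases h : a = loc ω.1 ∧ b = loc ω.2
  · rw [entryDist, if_pos h]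
  · exact (le_add_of_nonneg_right hL).trans (tdist1_add_le_entryDist h)

omit [Fintype p] [DecidableEq p] [NormedAddCommGroup E] [NormedSpace ℂ E] in
/-- `hdom` in the tree's wording. [cite: Balaban1984PropagatorsII, (2.54) p.233] -/
theorem domBy_entryDist (hL : 0 ≤ L) (ω : p × p) :
    DomBy (toB6 (torusGeom Nf 0 0 0) 0 True) (entryDist loc X hX L ω) :=
  fun a b => tdist1_le_entryDist hL ω a b

omit [Fintype p] [DecidableEq p] [NormedAddCommGroup E] [NormedSpace ℂ E] in
/-- **THROUGH-CLAUSE FROM THE GEODESIC LETTER**: if the entry's own pair of locations is joined by a `d₁`-geodesic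
through a point of `X`, its entry distance passes through `X` (off the own pair, `D_X + L` does by construction).
[cite: Balaban1985BackgroundPropagators, (3.93) p.410; Balaban1988RG2Cluster, p.13] -/
theorem through_entryDist (hL : 0 ≤ L) {ω : p × p}
    (hgeo : ∃ z ∈ X, tdist1 Nf (loc ω.1) z + tdist1 Nf z (loc ω.2) ≤ tdist1 Nf (loc ω.1) (loc ω.2)) :
    Through (toB6 (torusGeom Nf 0 0 0) 0 True) (entryDist loc X hX L ω) (↑X : Set (UT Nf)) := by
  intro y y'
  by_cases h : y = loc ω.1 ∧ y' = loc ω.2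
  · obtain ⟨h1, h2⟩ := h
    subst h1; subst h2
    obtain ⟨z, hz, hle⟩ := hgeo
    refine ⟨z, Finset.mem_coe.2 hz, ?_⟩
    rw [entryDist_self]
    exact hle
  · have hD : entryDist loc X hX L ω y y' = passDist (g := toB6 (torusGeom Nf 0 0 0) 0 True) X hX y y' + L :=
      if_neg h
    obtain ⟨z, hz, hle⟩ := through_passDist (g := toB6 (torusGeom Nf 0 0 0) 0 True) X hX y y'
    refine ⟨z, hz, ?_⟩
    rw [hD]
    exact hle.trans (le_add_of_nonneg_right hL)

end Lemmas

/-! ## §2. The entrywise packaging is a σ-free joint walk expansion -/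

/-- **T-56.1 — THE ENTRYWISE JOINT WALK EXPANSION.**  Letters (decay at rate `ρ`, holomorphy, symmetry) on the `R`-ball,
a fibre bound `m_F` of the locations, a drop `ε < ρ`, a torus rate `κ ≤ ρ − ε`, and an off-end length
`L ≥ |p × p|∕(ρ − ε)`, `L ≥ 0` ⟹ `Δ₀ = Σ_{(i,j)} T_{(i,j)}` is a σ-FREE `JointWalkExpansion` through `X` (any non-empty `X`)
at `(R, ε, κ, B(m_F² + 1))` with `SX = ∅`, amplitudes `B`, the entry walk distances and rate `ρ`.
[cite: Balaban1985BackgroundPropagators, Thm 3.10 (3.107)–(3.108) p.416, (3.93) p.410; Balaban1988RG2Cluster, (1.11) p.5, p.13, p.15] -/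
theorem jointWalkExpansion_entrywise (c : B13.Consts) {Δ₀ : E → Matrix p p ℂ} {loc : p → UT Nf}
    {X : Finset (UT Nf)} (hX : X.Nonempty) {R ρ B ε kap L : ℝ} (hL : EntryLetters Δ₀ loc R ρ B)
    (hρε : ε < ρ) (hkap : kap ≤ ρ - ε) (hL0 : 0 ≤ L) (hLW : (Fintype.card (p × p) : ℝ) ≤ (ρ - ε) * L)
    {mF : ℕ} (hfib : ∀ y : UT Nf, (Finset.univ.filter fun k => loc k = y).card ≤ mF) :
    JointWalkExpansion c loc loc (fun (_ : TPt d N' → ℂ) => Δ₀) X R ε kap (B * (mF * mF + 1))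
      (fun ω (_ : TPt d N' → ℂ) => entryTerm Δ₀ ω) (∅ : Set (p × p)) (fun _ => B)
      (entryDist loc X hX L) ρ where
  hasSum σ hσ u hu i j := by
    have hs : ∑ ω : p × p, entryTerm Δ₀ ω u i j = Δ₀ u i j := by
      rw [Finset.sum_eq_single (i, j)]
      · rw [show entryTerm Δ₀ (i, j) u i j = (Δ₀ u i j + Δ₀ u j i) / 2 from if_pos ⟨rfl, rfl⟩,
          ← hL.symm u hu i j]
        ring
      · intro ω _ hω
        refine entryTerm_of_ne fun h' => hω ?_
        exact Prod.ext h'.1.symm h'.2.symm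
      · intro h
        exact absurd (Finset.mem_univ _) h
    have h := hasSum_fintype fun ω : p × p => entryTerm Δ₀ ω u i j
    rwa [hs] at h
  termAnalytic ω σ hσ i j := by
    by_cases h : i = ω.1 ∧ j = ω.2
    · simp only [entryTerm, if_pos h, div_eq_mul_inv]
      have h1 : DifferentiableOn ℂ (fun u => Δ₀ u ω.1 ω.2 + Δ₀ u ω.2 ω.1) (ball (0 : E) R) :=
        (hL.holo ω.1 ω.2).add (hL.holo ω.2 ω.1)
      exact h1.mul_const _
    · simp only [entryTerm, if_neg h]
      exact differentiableOn_const 0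
  maj ω σ hσ u hu i j := by
    by_cases h : i = ω.1 ∧ j = ω.2
    · obtain ⟨h1, h2⟩ := h
      subst h1; subst h2
      rw [entryTerm_self, entryDist_self]
      have h1 := hL.decay u hu ω.1 ω.2
      have h2 := hL.decay u hu ω.2 ω.1
      rw [tdist1_comm (loc ω.2) (loc ω.1)] at h2
      have hn : ‖(Δ₀ u ω.1 ω.2 + Δ₀ u ω.2 ω.1) / 2‖ ≤ (‖Δ₀ u ω.1 ω.2‖ + ‖Δ₀ u ω.2 ω.1‖) / 2 := by
        rw [norm_div, Complex.norm_two]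
        gcongr
        exact norm_add_le _ _
      linarith
    · rw [entryTerm_of_ne h, norm_zero]
      exact mul_nonneg hL.B_nonneg (Real.exp_nonneg _)
  majSum := by
    intro S a b
    change UT Nf at a b
    dsimp only
    have hρε' : 0 < ρ - ε := sub_pos.2 hρε
    have ht : 0 ≤ tdist1 Nf a b := tdist1_nonneg a b
    have hB := hL.B_nonneg
    have he0 : 0 ≤ Real.exp (-((ρ - ε) * tdist1 Nf a b)) := Real.exp_nonneg _
    -- pointwise bounds on the two parts
    have hown : ∀ ω ∈ S.filter (fun ω : p × p => loc ω.1 = a ∧ loc ω.2 = b),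
        B * Real.exp (-((ρ - ε) * entryDist loc X hX L ω a b)) ≤ B * Real.exp (-((ρ - ε) * tdist1 Nf a b)) := by
      intro ω hω
      obtain ⟨h1, h2⟩ := (Finset.mem_filter.1 hω).2
      have hD : entryDist loc X hX L ω a b = tdist1 Nf a b := if_pos ⟨h1.symm, h2.symm⟩
      rw [hD]
    have hfar : ∀ ω ∈ S.filter (fun ω : p × p => ¬(loc ω.1 = a ∧ loc ω.2 = b)),
        B * Real.exp (-((ρ - ε) * entryDist loc X hX L ω a b)) ≤
          B * (Real.exp (-((ρ - ε) * tdist1 Nf a b)) * Real.exp (-((ρ - ε) * L))) := by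
      intro ω hω
      have hn := (Finset.mem_filter.1 hω).2
      have hD : tdist1 Nf a b + L ≤ entryDist loc X hX L ω a b :=
        tdist1_add_le_entryDist fun h' => hn ⟨h'.1.symm, h'.2.symm⟩
      refine mul_le_mul_of_nonneg_left ?_ hB
      rw [← Real.exp_add]
      exact Real.exp_le_exp.2 (by nlinarith)
    -- counting the two parts
    have hcard_own : ((S.filter (fun ω : p × p => loc ω.1 = a ∧ loc ω.2 = b)).card : ℝ)
        ≤ mF * mF := by
      have hsub : S.filter (fun ω : p × p => loc ω.1 = a ∧ loc ω.2 = b) ⊆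
          (Finset.univ.filter fun k => loc k = a) ×ˢ (Finset.univ.filter fun k => loc k = b) := by
        intro ω hω
        obtain ⟨h1, h2⟩ := (Finset.mem_filter.1 hω).2
        exact Finset.mem_product.2 ⟨Finset.mem_filter.2 ⟨Finset.mem_univ _, h1⟩,
          Finset.mem_filter.2 ⟨Finset.mem_univ _, h2⟩⟩
      have hc := Finset.card_le_card hsub
      rw [Finset.card_product] at hc
      have ha : ((Finset.univ.filter fun k => loc k = a).card : ℝ) ≤ mF := by exact_mod_cast hfib a
      have hb : ((Finset.univ.filter fun k => loc k = b).card : ℝ) ≤ mF := by exact_mod_cast hfib b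
      calc ((S.filter (fun ω : p × p => loc ω.1 = a ∧ loc ω.2 = b)).card : ℝ)
          ≤ ((Finset.univ.filter fun k => loc k = a).card : ℝ) * (Finset.univ.filter fun k => loc k = b).card := by
            exact_mod_cast hc
        _ ≤ mF * mF := mul_le_mul ha hb (Nat.cast_nonneg _) (Nat.cast_nonneg _)
    have hcard_far : ((S.filter (fun ω : p × p => ¬(loc ω.1 = a ∧ loc ω.2 = b))).card : ℝ) *
        Real.exp (-((ρ - ε) * L)) ≤ 1 := by
      have h1 : ((S.filter (fun ω : p × p => ¬(loc ω.1 = a ∧ loc ω.2 = b))).card : ℝ)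
          ≤ Fintype.card (p × p) := by
        exact_mod_cast Finset.card_le_univ _
      have h2 : (Fintype.card (p × p) : ℝ) ≤ Real.exp ((ρ - ε) * L) :=
        hLW.trans ((le_add_of_nonneg_right zero_le_one).trans (Real.add_one_le_exp _))
      calc ((S.filter (fun ω : p × p => ¬(loc ω.1 = a ∧ loc ω.2 = b))).card : ℝ) *
            Real.exp (-((ρ - ε) * L))
          ≤ Real.exp ((ρ - ε) * L) * Real.exp (-((ρ - ε) * L)) :=
            mul_le_mul_of_nonneg_right (h1.trans h2) (Real.exp_nonneg _)
        _ = 1 := by rw [← Real.exp_add, add_neg_cancel, Real.exp_zero]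
    -- assembling
    rw [← Finset.sum_filter_add_sum_filter_not S
      (fun ω : p × p => loc ω.1 = a ∧ loc ω.2 = b)]
    refine (add_le_add (Finset.sum_le_card_nsmul _ _ _ hown) (Finset.sum_le_card_nsmul _ _ _ hfar)).trans ?_
    rw [nsmul_eq_mul, nsmul_eq_mul]
    have hexp : Real.exp (-((ρ - ε) * tdist1 Nf a b)) ≤ Real.exp (-(kap * tdist1 Nf a b)) :=
      Real.exp_le_exp.2 (by nlinarith)
    calc ((S.filter (fun ω : p × p => loc ω.1 = a ∧ loc ω.2 = b)).card : ℝ) *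
            (B * Real.exp (-((ρ - ε) * tdist1 Nf a b))) +
          ((S.filter (fun ω : p × p => ¬(loc ω.1 = a ∧ loc ω.2 = b))).card : ℝ) *
            (B * (Real.exp (-((ρ - ε) * tdist1 Nf a b)) * Real.exp (-((ρ - ε) * L))))
        = ((S.filter (fun ω : p × p => loc ω.1 = a ∧ loc ω.2 = b)).card : ℝ) *
            (B * Real.exp (-((ρ - ε) * tdist1 Nf a b))) +
          (B * Real.exp (-((ρ - ε) * tdist1 Nf a b))) *
            (((S.filter (fun ω : p × p => ¬(loc ω.1 = a ∧ loc ω.2 = b))).card : ℝ) *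
              Real.exp (-((ρ - ε) * L))) := by ring
      _ ≤ (mF * mF) * (B * Real.exp (-((ρ - ε) * tdist1 Nf a b))) +
          (B * Real.exp (-((ρ - ε) * tdist1 Nf a b))) * 1 :=
          add_le_add (mul_le_mul_of_nonneg_right hcard_own (mul_nonneg hB he0))
            (mul_le_mul_of_nonneg_left hcard_far (mul_nonneg hB he0))
      _ = B * (mF * mF + 1) * Real.exp (-((ρ - ε) * tdist1 Nf a b)) := by ring
      _ ≤ B * (mF * mF + 1) * Real.exp (-(kap * tdist1 Nf a b)) :=
          mul_le_mul_of_nonneg_left hexp (by positivity)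
  indep ω hω σ hσ := rfl
  through ω hω := absurd hω (by simp)
  A_nonneg ω := hL.B_nonneg
  D_nonneg ω a b := (tdist1_nonneg a b).trans (tdist1_le_entryDist hL0 ω a b)

/-! ## §3. Every hypothesis of module 24 discharged from the letters -/

/-- **THE GEOMETRIC DECORATION LETTER** (named hypothesis shape on `J : p × p → Finset (cubes)`): the cube sets do not see
the orientation of the entry; the number of σ₀-cubes charged to the entry `(i,j)` is at most `c₀ + d₁(i,j)∕M₁` (a
`d₁`-geodesic of length `ℓ` meets at most `c₀ + ℓ∕M₁` cubes of side `M₁`); a decorated entry's locations are joined by a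
`d₁`-geodesic through a point of `X` (the charged cubes are σ₀-cubes, whose sites lie in `X`).
[cite: Balaban1988RG2Cluster, (1.11) p.5, p.13] -/
structure GeodesicDecoration (J : p × p → Finset (TPt d N')) (loc : p → UT Nf) (X : Finset (UT Nf))
    (c₀ : ℕ) (M₁ : ℝ) : Prop where
  symm : ∀ i j, J (j, i) = J (i, j)
  card_le : ∀ i j, ((J (i, j)).card : ℝ) ≤ c₀ + tdist1 Nf (loc i) (loc j) / M₁
  through : ∀ i j, (J (i, j)).Nonempty →
    ∃ z ∈ X, tdist1 Nf (loc i) z + tdist1 Nf z (loc j) ≤ tdist1 Nf (loc i) (loc j)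
  M₁_pos : 0 < M₁

/-- MODEL.  **THE ONE-CUBE INSTANCE of the geometric letter** (non-vacuity, and the faithful case `σ₀ = {□₀}` with
site set `X`): charge the entry `(i,j)` the single parameter `s(□₀)` iff `X` lies geodesically between its locations.
[cite: Balaban1988RG2Cluster, p.3 (after (1.7)), p.13] -/
def oneCubeDecoration (loc : p → UT Nf) (X : Finset (UT Nf)) (cube : TPt d N') (ω : p × p) : Finset (TPt d N') :=
  by
    classical
    exact if ∃ z ∈ X, tdist1 Nf (loc ω.1) z + tdist1 Nf z (loc ω.2) ≤ tdist1 Nf (loc ω.1) (loc ω.2) then {cube}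
      else ∅

omit [Fintype p] [DecidableEq p] in
/-- **T-56.4 — the one-cube decoration IS a geodesic decoration** with `c₀ = 1`, any cube side `M₁ > 0`.
[cite: Balaban1988RG2Cluster, p.3 (after (1.7)), (1.11) p.5, p.13] -/
theorem geodesicDecoration_oneCube (loc : p → UT Nf) (X : Finset (UT Nf)) (cube : TPt d N') {M₁ : ℝ}
    (hM₁ : 0 < M₁) : GeodesicDecoration (oneCubeDecoration loc X cube) loc X 1 M₁ := by
  classical
  refine ⟨fun i j => ?_, fun i j => ?_, fun i j hne => ?_, hM₁⟩
  · -- symmetry: the betweenness condition is symmetric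
    have hiff : (∃ z ∈ X, tdist1 Nf (loc j) z + tdist1 Nf z (loc i) ≤ tdist1 Nf (loc j) (loc i)) ↔
        (∃ z ∈ X, tdist1 Nf (loc i) z + tdist1 Nf z (loc j) ≤ tdist1 Nf (loc i) (loc j)) := by
      constructor
      · rintro ⟨z, hz, h⟩
        refine ⟨z, hz, ?_⟩
        rw [tdist1_comm (loc i) z, tdist1_comm z (loc j), tdist1_comm (loc i) (loc j)]; linarith
      · rintro ⟨z, hz, h⟩
        refine ⟨z, hz, ?_⟩
        rw [tdist1_comm (loc j) z, tdist1_comm z (loc i), tdist1_comm (loc j) (loc i)]; linarith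
    simp only [oneCubeDecoration]
    by_cases h : ∃ z ∈ X, tdist1 Nf (loc i) z + tdist1 Nf z (loc j) ≤ tdist1 Nf (loc i) (loc j)
    · rw [if_pos h, if_pos (hiff.2 h)]
    · rw [if_neg h, if_neg fun h' => h (hiff.1 h')]
  · -- cube count ≤ 1 ≤ 1 + ℓ/M₁
    have h1 : ((oneCubeDecoration loc X cube (i, j)).card : ℝ) ≤ 1 := by
      simp only [oneCubeDecoration]
      split_ifs <;> simp
    have h2 : 0 ≤ tdist1 Nf (loc i) (loc j) / M₁ := div_nonneg (tdist1_nonneg _ _) hM₁.le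
    push_cast
    linarith
  · -- through: a charged entry has X geodesically between its locations, by definition
    simp only [oneCubeDecoration] at hne
    by_contra h
    rw [if_neg h] at hne
    exact absurd hne (by simp)

section Structured

variable {c : B13.Consts} {Δ₀ : E → Matrix p p ℂ} {loc : p → UT Nf} {X : Finset (UT Nf)}
variable {R ρ B ε kap : ℝ} {mF : ℕ} {J : p × p → Finset (TPt d N')} {c₀ : ℕ} {M₁ η : ℝ}

/-- MODEL.  The off-end length used: `|p × p|∕(ρ − ε) + M₁·max_ω |J(ω)|`. [folklore] -/
def offLen (J : p × p → Finset (TPt d N')) (ρ ε M₁ : ℝ) : ℝ :=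
  Fintype.card (p × p) / (ρ - ε) + M₁ * ((Finset.univ.sup fun ω : p × p => (J ω).card : ℕ) : ℝ)

omit [DecidableEq p] in
/-- `offLen ≥ 0` for `ε < ρ`, `M₁ > 0`. [cite: Balaban1988RG2Cluster, (1.11) p.5] -/
theorem offLen_nonneg (hρε : ε < ρ) (hM₁ : 0 < M₁) : 0 ≤ offLen J ρ ε M₁ :=
  add_nonneg (div_nonneg (Nat.cast_nonneg _) (sub_pos.2 hρε).le) (mul_nonneg hM₁.le (Nat.cast_nonneg _))

omit [DecidableEq p] in
/-- `|p × p| ≤ (ρ − ε)·offLen`. [cite: Balaban1988RG2Cluster, (1.11) p.5] -/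
theorem card_le_offLen (hρε : ε < ρ) (hM₁ : 0 < M₁) :
    (Fintype.card (p × p) : ℝ) ≤ (ρ - ε) * offLen J ρ ε M₁ := by
  have hρε' : 0 < ρ - ε := sub_pos.2 hρε
  rw [offLen, mul_add, mul_div_cancel₀ _ hρε'.ne']
  exact le_add_of_nonneg_right (mul_nonneg hρε'.le (mul_nonneg hM₁.le (Nat.cast_nonneg _)))

omit [DecidableEq p] in
/-- `M₁·|J(ω)| ≤ offLen`. [cite: Balaban1988RG2Cluster, (1.11) p.5] -/
theorem card_mul_le_offLen (hρε : ε < ρ) (ω : p × p) :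
    M₁ * (J ω).card ≤ offLen J ρ ε M₁ ∨ M₁ < 0 := by
  by_cases hM₁ : 0 ≤ M₁
  · left
    have h1 : ((J ω).card : ℝ) ≤ ((Finset.univ.sup fun ω : p × p => (J ω).card : ℕ) : ℝ) := by
      exact_mod_cast Finset.le_sup (f := fun ω : p × p => (J ω).card) (Finset.mem_univ ω)
    rw [offLen]
    exact (mul_le_mul_of_nonneg_left h1 hM₁).trans
      (le_add_of_nonneg_left (div_nonneg (Nat.cast_nonneg _) (sub_pos.2 hρε).le))
  · right; exact lt_of_not_ge hM₁

omit [DecidableEq p] in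
/-- **PRINT'S DICHOTOMY (P1) FROM THE CUBE COUNT** with `m₀ = 2c₀`, `δ₁M = ρM₁∕2`: an entry of length `ℓ ≤ M₁c₀` is
charged at most `2c₀` cubes; a longer one at most `2ℓ∕M₁`, and off its own pair the entry distance exceeds `offLen ≥ M₁·|J|`.
[cite: Balaban1988RG2Cluster, (1.11) p.5] -/
theorem dichotomy_entrywise (hX : X.Nonempty) (hG : GeodesicDecoration J loc X c₀ M₁) (hρε : ε < ρ) (hε : 0 ≤ ε) :
    ∀ ω : p × p, (J ω).card ≤ 2 * c₀ ∨
      ∀ a b, ρ * M₁ / 2 * (J ω).card ≤ ρ * entryDist loc X hX (offLen J ρ ε M₁) ω a b := by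
  intro ω
  have hM₁ := hG.M₁_pos
  have hρ : 0 < ρ := lt_of_le_of_lt hε hρε
  have hcard := hG.card_le ω.1 ω.2
  have hc0 : (0 : ℝ) ≤ (J ω).card := Nat.cast_nonneg _
  by_cases hℓ : tdist1 Nf (loc ω.1) (loc ω.2) ≤ M₁ * c₀
  · left
    have h1 : tdist1 Nf (loc ω.1) (loc ω.2) / M₁ ≤ c₀ := by
      rw [div_le_iff₀ hM₁]; linarith [mul_comm M₁ (c₀ : ℝ)]
    have h2 : ((J ω).card : ℝ) ≤ 2 * c₀ := by
      have : ((J (ω.1, ω.2)).card : ℝ) = (J ω).card := rfl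
      linarith
    exact_mod_cast h2
  · right
    intro a b
    have hℓ : M₁ * c₀ < tdist1 Nf (loc ω.1) (loc ω.2) := lt_of_not_ge hℓ
    by_cases hab : a = loc ω.1 ∧ b = loc ω.2
    · obtain ⟨h1, h2⟩ := hab
      subst h1; subst h2
      rw [entryDist_self]
      -- card ≤ c₀ + ℓ/M₁ ≤ 2ℓ/M₁
      have h3 : (c₀ : ℝ) ≤ tdist1 Nf (loc ω.1) (loc ω.2) / M₁ := by
        rw [le_div_iff₀ hM₁]; linarith [mul_comm M₁ (c₀ : ℝ)]
      have h4 : ((J ω).card : ℝ) ≤ 2 * (tdist1 Nf (loc ω.1) (loc ω.2) / M₁) := by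
        have : ((J (ω.1, ω.2)).card : ℝ) = (J ω).card := rfl
        linarith
      calc ρ * M₁ / 2 * (J ω).card ≤ ρ * M₁ / 2 * (2 * (tdist1 Nf (loc ω.1) (loc ω.2) / M₁)) :=
            mul_le_mul_of_nonneg_left h4 (by positivity)
        _ = ρ * tdist1 Nf (loc ω.1) (loc ω.2) := by field_simp
    · have hD : tdist1 Nf a b + offLen J ρ ε M₁ ≤ entryDist loc X hX (offLen J ρ ε M₁) ω a b :=
        tdist1_add_le_entryDist hab
      have hO : M₁ * (J ω).card ≤ offLen J ρ ε M₁ := by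
        rcases card_mul_le_offLen (J := J) (ρ := ρ) (ε := ε) (M₁ := M₁) hρε ω with h | h
        · exact h
        · exact absurd h (not_lt.2 hM₁.le)
      have ht := tdist1_nonneg (N := Nf) a b
      have h5 : M₁ * (J ω).card ≤ entryDist loc X hX (offLen J ρ ε M₁) ω a b := by linarith
      have h6 : 0 ≤ M₁ * (J ω).card := mul_nonneg hM₁.le hc0
      have h7 : ρ * (M₁ * (J ω).card) ≤ ρ * entryDist loc X hX (offLen J ρ ε M₁) ω a b :=
        mul_le_mul_of_nonneg_left h5 hρ.le
      calc ρ * M₁ / 2 * (J ω).card = ρ * (M₁ * (J ω).card) / 2 := by ring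
        _ ≤ ρ * (M₁ * (J ω).card) := by linarith [mul_nonneg hρ.le h6]
        _ ≤ ρ * entryDist loc X hX (offLen J ρ ε M₁) ω a b := h7

/-- **T-56.2 — PRINT's-FORM STRUCTURED DATUM FROM ENTRYWISE LETTERS** (module 24 §2 `structuredExpansion_sDecorate` with
EVERY hypothesis discharged): the three letters of `Δ₀` on the `R`-ball, a fibre bound, the geometric decoration letter,
and the numerics `0 < η ≤ ε < ρ`, `κ ≤ ρ − ε`, `2κ₁ ≤ ηM₁` ⟹ `∃ W T SX A D ρ′ J′ T0 rev′`: a joint walk expansion of the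
Hadamard-conditioned kernel `sDecorate J (entryTerm Δ₀)` through `X` at `(R, ε − η, κ, e^{2c₀κ₁}B(m_F²+1))` with
s-monomial terms and a walk reversal. [cite: Balaban1988RG2Cluster, p.3 (after (1.7)), (1.11) p.5, p.13, p.15; Balaban1985BackgroundPropagators, (3.93) p.410, Thm 3.10 (3.107)–(3.108) p.416] -/
theorem structuredExpansion_entrywise (hκ₁ : 0 ≤ c.κ₁) (hX : X.Nonempty) (hL : EntryLetters Δ₀ loc R ρ B)
    (hfib : ∀ y : UT Nf, (Finset.univ.filter fun k => loc k = y).card ≤ mF)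
    (hG : GeodesicDecoration J loc X c₀ M₁)
    (hη : 0 < η) (hηε : η ≤ ε) (hρε : ε < ρ) (hkap : kap ≤ ρ - ε) (hP2 : 2 * c.κ₁ ≤ η * M₁) :
    ∃ (W' : Type) (T : W' → (TPt d N' → ℂ) → E → Matrix p p ℂ) (SX : Set W') (A' : W' → ℝ)
      (D' : W' → UT Nf → UT Nf → ℝ) (ρ' : ℝ) (J' : W' → Finset (TPt d N')) (T0 : W' → E → Matrix p p ℂ)
      (rev' : W' ≃ W'),
      JointWalkExpansion c loc loc (sDecorate J (entryTerm Δ₀)) X R (ε - η) kap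
          (Real.exp (c.κ₁ * (2 * c₀ : ℕ)) * (B * (mF * mF + 1))) T SX A' D' ρ' ∧
        (∀ ω σ u, T ω σ u = (∏ j ∈ J' ω, σ j) • T0 ω u) ∧ (∀ ω σ u i j, T (rev' ω) σ u i j = T ω σ u j i) := by
  have hM₁ := hG.M₁_pos
  have hε : 0 ≤ ε := hη.le.trans hηε
  have hρ : 0 < ρ := lt_of_le_of_lt hε hρε
  have h₀ := jointWalkExpansion_entrywise (d := d) (N' := N') c hX hL hρε hkap (offLen_nonneg hρε hM₁)
    (card_le_offLen (J := J) hρε hM₁) hfib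
  exact structuredExpansion_sDecorate hκ₁ h₀ (Equiv.prodComm p p) (fun ω u i j => entryTerm_swap ω u i j) J
    (fun ω => hG.symm ω.1 ω.2) (m₀ := 2 * c₀) (dM := ρ * M₁ / 2) (η := η) (by positivity) hη.le hηε
    (dichotomy_entrywise hX hG hρε hε) (by nlinarith)
    (fun ω hne => through_entryDist (offLen_nonneg hρε hM₁) (hG.through ω.1 ω.2 hne))

variable {n : Type}

/-- **T-56.3 — THE `hKexp` DATUM OF THE N10 JUNCTION FOR `Cᵀ·Δ(s,·)·C`, Δ HADAMARD-CONDITIONED, FROM ENTRYWISE LETTERS**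
(module 24 §3 `structuredExpansion_sandwich_sDecorate` with EVERY walk-side hypothesis discharged; the `C`-side binders
— real constant local `C`, `|C| ≤ 1`, range `r_C`, junction rate `μ` — are the junction's own and stay).
[cite: Balaban1988RG2Cluster, p.3, (1.11) p.5, (2.5) p.12, p.13, p.15; Balaban1985BackgroundPropagators, (3.93) p.410, (3.107)–(3.108) p.416] -/
theorem structuredExpansion_sandwich_entrywise {locN : n → UT Nf} (hκ₁ : 0 ≤ c.κ₁) (hX : X.Nonempty)
    (hL : EntryLetters Δ₀ loc R ρ B) (hfib : ∀ y : UT Nf, (Finset.univ.filter fun k => loc k = y).card ≤ mF)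
    (hG : GeodesicDecoration J loc X c₀ M₁)
    (hη : 0 < η) (hηε : η ≤ ε) (hρε : ε < ρ) (hP2 : 2 * c.κ₁ ≤ η * M₁)
    (C : Matrix p n ℝ) {rC : ℝ} (hCle : ∀ k i, |C k i| ≤ 1)
    (hCsupp : ∀ k i, C k i ≠ 0 → tdist1 Nf (loc k) (locN i) ≤ rC)
    {μ : ℝ} (hμ : 0 < μ) (hμε : 2 * μ ≤ ε - η) (hμκ : 2 * μ ≤ kap) (hκε : kap ≤ ρ - ε) :
    ∃ (W' : Type) (T' : W' → (TPt d N' → ℂ) → E → Matrix n n ℂ) (SX' : Set W') (A' : W' → ℝ)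
      (D' : W' → UT Nf → UT Nf → ℝ) (ρ' : ℝ) (J' : W' → Finset (TPt d N')) (T0' : W' → E → Matrix n n ℂ)
      (rev' : W' ≃ W'),
      JointWalkExpansion c locN locN
          (fun σ u => (C.map (algebraMap ℝ ℂ))ᵀ * sDecorate J (entryTerm Δ₀) σ u * C.map (algebraMap ℝ ℂ)) X R
          (ε - η - μ - μ) (kap - μ - μ)
          ((mF * B6.c0 1 μ ^ ν) * ((mF * B6.c0 1 μ ^ ν) * Real.exp ((ρ - η) * rC) *
            (Real.exp (c.κ₁ * (2 * c₀ : ℕ)) * (B * (mF * mF + 1))) * B6.c0 1 μ ^ ν) *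
            Real.exp ((ρ - η - μ) * rC) * B6.c0 1 μ ^ ν) T' SX' A' D' ρ' ∧
        (∀ ω σ u, T' ω σ u = (∏ j ∈ J' ω, σ j) • T0' ω u) ∧ (∀ ω σ u i j, T' (rev' ω) σ u i j = T' ω σ u j i) := by
  have hM₁ := hG.M₁_pos
  have hε : 0 ≤ ε := hη.le.trans hηε
  have hρ : 0 < ρ := lt_of_le_of_lt hε hρε
  have h₀ := jointWalkExpansion_entrywise (d := d) (N' := N') c hX hL hρε hκε (offLen_nonneg hρε hM₁)
    (card_le_offLen (J := J) hρε hM₁) hfib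
  exact structuredExpansion_sandwich_sDecorate hκ₁ h₀
    (fun ω => domBy_entryDist (offLen_nonneg hρε hM₁) ω) (Equiv.prodComm p p)
    (fun ω u i j => entryTerm_swap ω u i j) J (fun ω => hG.symm ω.1 ω.2) (m₀ := 2 * c₀) (dM := ρ * M₁ / 2)
    (η := η) (by positivity) hη.le hηε (dichotomy_entrywise hX hG hρε hε) (by nlinarith)
    (fun ω hne => through_entryDist (offLen_nonneg hρε hM₁) (hG.through ω.1 ω.2 hne))
    C hCle hCsupp hfib hμ hμε hμκ (by linarith) (mul_nonneg hL.B_nonneg (by positivity))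

end Structured

/-! ## §4. What the conditioned operator is; the vacuity flag -/

omit [NormedAddCommGroup E] [NormedSpace ℂ E] in
/-- **THE HADAMARD FORM**: the conditioned operator of §3 is the entrywise product of the monomial matrix
`S(s)_{ab} = ∏_{□ ∈ J(a,b)} s(□)` with the symmetrised `Δ₀(u)` — another admissible conditioning in the sense of the
tree's module 24, NOT print's walk-decorated `Δ_k(σ)` (p. 3). [cite: Balaban1988RG2Cluster, p.3 (after (1.7))] -/
theorem sDecorate_entryTerm_apply (J : p × p → Finset (TPt d N')) (Δ₀ : E → Matrix p p ℂ)
    (σ : TPt d N' → ℂ) (u : E) (a b : p) :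
    sDecorate J (entryTerm Δ₀) σ u a b = (∏ k ∈ J (a, b), σ k) * ((Δ₀ u a b + Δ₀ u b a) / 2) := by
  rw [sDecorate_apply, tsum_fintype, Finset.sum_eq_single (a, b)]
  · rw [sTerm_apply, show entryTerm Δ₀ (a, b) u a b = (Δ₀ u a b + Δ₀ u b a) / 2 from if_pos ⟨rfl, rfl⟩]
  · intro ω _ hω
    rw [sTerm_apply, entryTerm_of_ne fun h' => hω (Prod.ext h'.1.symm h'.2.symm), mul_zero]
  · intro h
    exact absurd (Finset.mem_univ _) h

omit [NormedAddCommGroup E] [NormedSpace ℂ E] in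
/-- **DECOUPLING ACROSS A KILLED CUBE (the purpose of (1.11), Hadamard side)**: an entry charged the cube `k` vanishes
when `s(k) = 0`; with a WALL LETTER («every cube whose sites separate `loc a` from `loc b` is charged to `(a,b)`», NOT a
hypothesis of module 24) the conditioned operator is block-diagonal across any wall of killed cubes.
[cite: Balaban1988RG2Cluster, p.3 (after (1.7)), (2.5) p.12] -/
theorem sDecorate_entryTerm_eq_zero (J : p × p → Finset (TPt d N')) (Δ₀ : E → Matrix p p ℂ)
    {σ : TPt d N' → ℂ} (u : E) {a b : p} {k : TPt d N'} (hk : k ∈ J (a, b)) (hσ : σ k = 0) :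
    sDecorate J (entryTerm Δ₀) σ u a b = 0 := by
  rw [sDecorate_entryTerm_apply, Finset.prod_eq_zero hk hσ, zero_mul]

omit [NormedAddCommGroup E] [NormedSpace ℂ E] in
/-- **… and the two readings AGREE AT `s ≡ 1`** (the undecorated operator, symmetrised). [cite: Balaban1988RG2Cluster, p.3 (after (1.7))] -/
theorem sDecorate_entryTerm_one (J : p × p → Finset (TPt d N')) (Δ₀ : E → Matrix p p ℂ) (u : E) (a b : p) :
    sDecorate J (entryTerm Δ₀) (fun _ => 1) u a b = (Δ₀ u a b + Δ₀ u b a) / 2 := by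
  rw [sDecorate_entryTerm_apply, Finset.prod_const_one, one_mul]

omit [Fintype p] [DecidableEq p] in
/-- **THE VACUITY FLAG — THE TRIVIAL DECORATION IS ADMISSIBLE**: for ANY σ-free joint walk expansion of `Δ₀` with a walk
reversal, the EMPTY decoration `J ≡ ∅` meets every hypothesis of module 24 §2 (dichotomy by its first branch with
`m₀ = 0`, restriction (P2) with `δ₁M = (κ₁ρ + 1)∕η`, through-clause vacuous) at EVERY drop `0 < η ≤ ε` (so the junction's
rate bookkeeping `2μ ≤ ε − η` of module 24 §3 stays feasible): the junction's `hKexp` clauses accept a «conditioned»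
operator with NO `s`-dependence.  Where the decoupling purpose of (1.11) enters the DAG
is therefore NOT `hKexp` (located audit question for the record's `T₃` ∕ the dictionary binder `hT₃`).
[cite: Balaban1988RG2Cluster, (1.11) p.5, (2.5) p.12] -/
theorem structuredExpansion_undecorated {W : Type} {c : B13.Consts} (hκ₁ : 0 ≤ c.κ₁) {locF : p → UT Nf}
    {Δ₀ : E → Matrix p p ℂ} {X : Finset (UT Nf)} {R ε kap Kbar ρ : ℝ} {T₀ : W → E → Matrix p p ℂ} {SX₀ : Set W}
    {A : W → ℝ} {D : W → UT Nf → UT Nf → ℝ}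
    (h₀ : JointWalkExpansion c locF locF (fun (_ : TPt d N' → ℂ) => Δ₀) X R ε kap Kbar
      (fun ω (_ : TPt d N' → ℂ) => T₀ ω) SX₀ A D ρ)
    (rev : W ≃ W) (hrevT : ∀ ω u i j, T₀ (rev ω) u i j = T₀ ω u j i) {η : ℝ} (hη : 0 < η) (hηε : η ≤ ε)
    (hρ : 0 ≤ ρ) :
    ∃ (W' : Type) (T : W' → (TPt d N' → ℂ) → E → Matrix p p ℂ) (SX : Set W') (A' : W' → ℝ)
      (D' : W' → UT Nf → UT Nf → ℝ) (ρ' : ℝ) (J' : W' → Finset (TPt d N')) (T0 : W' → E → Matrix p p ℂ)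
      (rev' : W' ≃ W'),
      JointWalkExpansion c locF locF (sDecorate (fun _ : W => (∅ : Finset (TPt d N'))) T₀) X R (ε - η) kap
          (Real.exp (c.κ₁ * (0 : ℕ)) * Kbar) T SX A' D' ρ' ∧
        (∀ ω σ u, T ω σ u = (∏ j ∈ J' ω, σ j) • T0 ω u) ∧ (∀ ω σ u i j, T (rev' ω) σ u i j = T ω σ u j i) :=
  structuredExpansion_sDecorate hκ₁ h₀ rev hrevT (fun _ => ∅) (fun _ => rfl) (m₀ := 0)
    (dM := (c.κ₁ * ρ + 1) * η⁻¹) (η := η)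
    (mul_pos (by linarith [mul_nonneg hκ₁ hρ]) (inv_pos.2 hη)) hη.le hηε (fun _ => Or.inl (by simp))
    (by
      have h1 : η * ((c.κ₁ * ρ + 1) * η⁻¹) = c.κ₁ * ρ + 1 := by
        rw [mul_comm, mul_assoc, inv_mul_cancel₀ hη.ne', mul_one]
      linarith)
    (fun ω hne => absurd hne (by simp))

/-! ## §5. After module 25 (`B13JointWalkExpansionSymmetrize`, p494535, landed during this seat): the symmetry letter
leaves the ask -/

section Raw

/-- MODEL.  The RAW entry term: the `(i,j)` entry of `Δ₀(u)` placed at `(i,j)`, unsymmetrised.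
[cite: Balaban1985BackgroundPropagators, (3.107) p.416] -/
def rawEntryTerm (Δ₀ : E → Matrix p p ℂ) (ω : p × p) (u : E) : Matrix p p ℂ :=
  fun a b => if a = ω.1 ∧ b = ω.2 then Δ₀ u ω.1 ω.2 else 0

/-- **TWO ENTRYWISE LETTERS of `Δ₀(u)` on the complex `R`-ball** (named hypothesis shape): `EntryLetters` minus `symm`.
[cite: Balaban1985BackgroundPropagators, Thm 3.10 (3.107)–(3.108) p.416] -/
structure RawEntryLetters (Δ₀ : E → Matrix p p ℂ) (loc : p → UT Nf) (R ρ B : ℝ) : Prop where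
  decay : ∀ u ∈ ball (0 : E) R, ∀ i j, ‖Δ₀ u i j‖ ≤ B * Real.exp (-(ρ * tdist1 Nf (loc i) (loc j)))
  holo : ∀ i j, DifferentiableOn ℂ (fun u => Δ₀ u i j) (ball (0 : E) R)
  B_nonneg : 0 ≤ B

omit [Fintype p] [DecidableEq p] in
/-- Three letters give two. [cite: Balaban1985BackgroundPropagators, (3.108) p.416] -/
theorem EntryLetters.raw {Δ₀ : E → Matrix p p ℂ} {loc : p → UT Nf} {R ρ B : ℝ} (h : EntryLetters Δ₀ loc R ρ B) :
    RawEntryLetters Δ₀ loc R ρ B :=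
  ⟨h.decay, h.holo, h.B_nonneg⟩

omit [Fintype p] [NormedAddCommGroup E] [NormedSpace ℂ E] in
/-- The raw entry term at its own entry. [cite: Balaban1985BackgroundPropagators, (3.107) p.416] -/
theorem rawEntryTerm_self {Δ₀ : E → Matrix p p ℂ} (ω : p × p) (u : E) :
    rawEntryTerm Δ₀ ω u ω.1 ω.2 = Δ₀ u ω.1 ω.2 := if_pos ⟨rfl, rfl⟩

omit [Fintype p] [NormedAddCommGroup E] [NormedSpace ℂ E] in
/-- The raw entry term vanishes off its own entry. [cite: Balaban1985BackgroundPropagators, (3.107) p.416] -/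
theorem rawEntryTerm_of_ne {Δ₀ : E → Matrix p p ℂ} {ω : p × p} {u : E} {a b : p} (h : ¬(a = ω.1 ∧ b = ω.2)) :
    rawEntryTerm Δ₀ ω u a b = 0 := if_neg h

variable {c : B13.Consts} {Δ₀ : E → Matrix p p ℂ} {loc : p → UT Nf} {X : Finset (UT Nf)}
variable {R ρ B ε kap : ℝ} {mF : ℕ} {J : p × p → Finset (TPt d N')} {c₀ : ℕ} {M₁ η : ℝ}

/-- **T-56.7 — A σ-FREE JOINT WALK EXPANSION OF `Δ₀` FROM TWO ENTRYWISE LETTERS** (decay, holomorphy — NO symmetry):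
the raw packaging (`W = p × p`, `T_{(i,j)} = Δ₀(u)_{ij}` at `(i,j)`, the entry distances of §1) is a σ-free
`JointWalkExpansion` of `Δ₀` through any non-empty `X` at `(R, ε, κ ≤ ρ − ε, B(m_F²+1))`, `L ≥ |p|²∕(ρ − ε)`; no walk
reversal is carried (the raw term family is not reversal-invariant unless `Δ₀` is symmetric).
[cite: Balaban1985BackgroundPropagators, (3.93) p.410, Thm 3.10 (3.107)–(3.108) p.416; Balaban1984PropagatorsII, (2.54) p.233] -/
theorem jointWalkExpansion_rawEntrywise (c : B13.Consts) {Δ₀ : E → Matrix p p ℂ} {loc : p → UT Nf}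
    {X : Finset (UT Nf)} (hX : X.Nonempty) {R ρ B ε kap L : ℝ} (hL : RawEntryLetters Δ₀ loc R ρ B)
    (hρε : ε < ρ) (hkap : kap ≤ ρ - ε) (hL0 : 0 ≤ L) (hLW : (Fintype.card (p × p) : ℝ) ≤ (ρ - ε) * L)
    {mF : ℕ} (hfib : ∀ y : UT Nf, (Finset.univ.filter fun k => loc k = y).card ≤ mF) :
    JointWalkExpansion c loc loc (fun (_ : TPt d N' → ℂ) => Δ₀) X R ε kap (B * (mF * mF + 1))
      (fun ω (_ : TPt d N' → ℂ) => rawEntryTerm Δ₀ ω) (∅ : Set (p × p)) (fun _ => B)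
      (entryDist loc X hX L) ρ where
  hasSum σ hσ u hu i j := by
    have hs : ∑ ω : p × p, rawEntryTerm Δ₀ ω u i j = Δ₀ u i j := by
      rw [Finset.sum_eq_single (i, j)]
      · exact rawEntryTerm_self (i, j) u
      · intro ω _ hω
        refine rawEntryTerm_of_ne fun h' => hω ?_
        exact Prod.ext h'.1.symm h'.2.symm
      · intro h
        exact absurd (Finset.mem_univ _) h
    have h := hasSum_fintype fun ω : p × p => rawEntryTerm Δ₀ ω u i j
    rwa [hs] at h
  termAnalytic ω σ hσ i j := by
    by_cases h : i = ω.1 ∧ j = ω.2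
    · simp only [rawEntryTerm, if_pos h]
      exact hL.holo ω.1 ω.2
    · simp only [rawEntryTerm, if_neg h]
      exact differentiableOn_const 0
  maj ω σ hσ u hu i j := by
    by_cases h : i = ω.1 ∧ j = ω.2
    · obtain ⟨h1, h2⟩ := h
      subst h1; subst h2
      rw [rawEntryTerm_self, entryDist_self]
      exact hL.decay u hu ω.1 ω.2
    · rw [rawEntryTerm_of_ne h, norm_zero]
      exact mul_nonneg hL.B_nonneg (Real.exp_nonneg _)
  majSum := by
    intro S a b
    change UT Nf at a b
    dsimp only
    have hρε' : 0 < ρ - ε := sub_pos.2 hρε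
    have ht : 0 ≤ tdist1 Nf a b := tdist1_nonneg a b
    have hB := hL.B_nonneg
    have he0 : 0 ≤ Real.exp (-((ρ - ε) * tdist1 Nf a b)) := Real.exp_nonneg _
    -- pointwise bounds on the two parts
    have hown : ∀ ω ∈ S.filter (fun ω : p × p => loc ω.1 = a ∧ loc ω.2 = b),
        B * Real.exp (-((ρ - ε) * entryDist loc X hX L ω a b)) ≤ B * Real.exp (-((ρ - ε) * tdist1 Nf a b)) := by
      intro ω hω
      obtain ⟨h1, h2⟩ := (Finset.mem_filter.1 hω).2
      have hD : entryDist loc X hX L ω a b = tdist1 Nf a b := if_pos ⟨h1.symm, h2.symm⟩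
      rw [hD]
    have hfar : ∀ ω ∈ S.filter (fun ω : p × p => ¬(loc ω.1 = a ∧ loc ω.2 = b)),
        B * Real.exp (-((ρ - ε) * entryDist loc X hX L ω a b)) ≤
          B * (Real.exp (-((ρ - ε) * tdist1 Nf a b)) * Real.exp (-((ρ - ε) * L))) := by
      intro ω hω
      have hn := (Finset.mem_filter.1 hω).2
      have hD : tdist1 Nf a b + L ≤ entryDist loc X hX L ω a b :=
        tdist1_add_le_entryDist fun h' => hn ⟨h'.1.symm, h'.2.symm⟩
      refine mul_le_mul_of_nonneg_left ?_ hB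
      rw [← Real.exp_add]
      exact Real.exp_le_exp.2 (by nlinarith)
    -- counting the two parts
    have hcard_own : ((S.filter (fun ω : p × p => loc ω.1 = a ∧ loc ω.2 = b)).card : ℝ)
        ≤ mF * mF := by
      have hsub : S.filter (fun ω : p × p => loc ω.1 = a ∧ loc ω.2 = b) ⊆
          (Finset.univ.filter fun k => loc k = a) ×ˢ (Finset.univ.filter fun k => loc k = b) := by
        intro ω hω
        obtain ⟨h1, h2⟩ := (Finset.mem_filter.1 hω).2
        exact Finset.mem_product.2 ⟨Finset.mem_filter.2 ⟨Finset.mem_univ _, h1⟩,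
          Finset.mem_filter.2 ⟨Finset.mem_univ _, h2⟩⟩
      have hc := Finset.card_le_card hsub
      rw [Finset.card_product] at hc
      have ha : ((Finset.univ.filter fun k => loc k = a).card : ℝ) ≤ mF := by exact_mod_cast hfib a
      have hb : ((Finset.univ.filter fun k => loc k = b).card : ℝ) ≤ mF := by exact_mod_cast hfib b
      calc ((S.filter (fun ω : p × p => loc ω.1 = a ∧ loc ω.2 = b)).card : ℝ)
          ≤ ((Finset.univ.filter fun k => loc k = a).card : ℝ) * (Finset.univ.filter fun k => loc k = b).card := by
            exact_mod_cast hc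
        _ ≤ mF * mF := mul_le_mul ha hb (Nat.cast_nonneg _) (Nat.cast_nonneg _)
    have hcard_far : ((S.filter (fun ω : p × p => ¬(loc ω.1 = a ∧ loc ω.2 = b))).card : ℝ) *
        Real.exp (-((ρ - ε) * L)) ≤ 1 := by
      have h1 : ((S.filter (fun ω : p × p => ¬(loc ω.1 = a ∧ loc ω.2 = b))).card : ℝ)
          ≤ Fintype.card (p × p) := by
        exact_mod_cast Finset.card_le_univ _
      have h2 : (Fintype.card (p × p) : ℝ) ≤ Real.exp ((ρ - ε) * L) :=
        hLW.trans ((le_add_of_nonneg_right zero_le_one).trans (Real.add_one_le_exp _))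
      calc ((S.filter (fun ω : p × p => ¬(loc ω.1 = a ∧ loc ω.2 = b))).card : ℝ) *
            Real.exp (-((ρ - ε) * L))
          ≤ Real.exp ((ρ - ε) * L) * Real.exp (-((ρ - ε) * L)) :=
            mul_le_mul_of_nonneg_right (h1.trans h2) (Real.exp_nonneg _)
        _ = 1 := by rw [← Real.exp_add, add_neg_cancel, Real.exp_zero]
    -- assembling
    rw [← Finset.sum_filter_add_sum_filter_not S
      (fun ω : p × p => loc ω.1 = a ∧ loc ω.2 = b)]
    refine (add_le_add (Finset.sum_le_card_nsmul _ _ _ hown) (Finset.sum_le_card_nsmul _ _ _ hfar)).trans ?_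
    rw [nsmul_eq_mul, nsmul_eq_mul]
    have hexp : Real.exp (-((ρ - ε) * tdist1 Nf a b)) ≤ Real.exp (-(kap * tdist1 Nf a b)) :=
      Real.exp_le_exp.2 (by nlinarith)
    calc ((S.filter (fun ω : p × p => loc ω.1 = a ∧ loc ω.2 = b)).card : ℝ) *
            (B * Real.exp (-((ρ - ε) * tdist1 Nf a b))) +
          ((S.filter (fun ω : p × p => ¬(loc ω.1 = a ∧ loc ω.2 = b))).card : ℝ) *
            (B * (Real.exp (-((ρ - ε) * tdist1 Nf a b)) * Real.exp (-((ρ - ε) * L))))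
        = ((S.filter (fun ω : p × p => loc ω.1 = a ∧ loc ω.2 = b)).card : ℝ) *
            (B * Real.exp (-((ρ - ε) * tdist1 Nf a b))) +
          (B * Real.exp (-((ρ - ε) * tdist1 Nf a b))) *
            (((S.filter (fun ω : p × p => ¬(loc ω.1 = a ∧ loc ω.2 = b))).card : ℝ) *
              Real.exp (-((ρ - ε) * L))) := by ring
      _ ≤ (mF * mF) * (B * Real.exp (-((ρ - ε) * tdist1 Nf a b))) +
          (B * Real.exp (-((ρ - ε) * tdist1 Nf a b))) * 1 :=
          add_le_add (mul_le_mul_of_nonneg_right hcard_own (mul_nonneg hB he0))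
            (mul_le_mul_of_nonneg_left hcard_far (mul_nonneg hB he0))
      _ = B * (mF * mF + 1) * Real.exp (-((ρ - ε) * tdist1 Nf a b)) := by ring
      _ ≤ B * (mF * mF + 1) * Real.exp (-(kap * tdist1 Nf a b)) :=
          mul_le_mul_of_nonneg_left hexp (by positivity)
  indep ω hω σ hσ := rfl
  through ω hω := absurd hω (by simp)
  A_nonneg ω := hL.B_nonneg
  D_nonneg ω a b := (tdist1_nonneg a b).trans (tdist1_le_entryDist hL0 ω a b)

variable {n : Type}

/-- **T-56.8 — THE `hKexp` DATUM OF THE N10 JUNCTION FROM TWO ENTRYWISE LETTERS, NO SYMMETRY, NO REVERSAL** (module 25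
§3 `structuredExpansion_sandwich_sDecorate_symm` with EVERY walk-side hypothesis discharged: the raw σ-free expansion
T-56.7, `hdom` by `domBy_entryDist`, (P1) by `dichotomy_entrywise`, (P2) from `2κ₁ ≤ ηM₁`, the through-clause from the
geometric letter; the `C`-side binders are the junction's own).  The conditioned operator is module 25's: the
decorated SYMMETRIZATION of the raw packaging (identified in T-56.9).
[cite: Balaban1988RG2Cluster, p.3, (1.11) p.5, (2.5) p.12, p.13, p.15; Balaban1985BackgroundPropagators, (3.93) p.410, (3.107)–(3.108) p.416] -/
theorem structuredExpansion_sandwich_rawEntrywise {locN : n → UT Nf} (hκ₁ : 0 ≤ c.κ₁) (hX : X.Nonempty)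
    (hL : RawEntryLetters Δ₀ loc R ρ B) (hfib : ∀ y : UT Nf, (Finset.univ.filter fun k => loc k = y).card ≤ mF)
    (hG : GeodesicDecoration J loc X c₀ M₁)
    (hη : 0 < η) (hηε : η ≤ ε) (hρε : ε < ρ) (hP2 : 2 * c.κ₁ ≤ η * M₁)
    (C : Matrix p n ℝ) {rC : ℝ} (hCle : ∀ k i, |C k i| ≤ 1)
    (hCsupp : ∀ k i, C k i ≠ 0 → tdist1 Nf (loc k) (locN i) ≤ rC)
    {μ : ℝ} (hμ : 0 < μ) (hμε : 2 * μ ≤ ε - η) (hμκ : 2 * μ ≤ kap) (hκε : kap ≤ ρ - ε) :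
    ∃ (W' : Type) (T' : W' → (TPt d N' → ℂ) → E → Matrix n n ℂ) (SX' : Set W') (A' : W' → ℝ)
      (D' : W' → UT Nf → UT Nf → ℝ) (ρ' : ℝ) (J' : W' → Finset (TPt d N')) (T0' : W' → E → Matrix n n ℂ)
      (rev' : W' ≃ W'),
      JointWalkExpansion c locN locN
          (fun σ u => (C.map (algebraMap ℝ ℂ))ᵀ *
            sDecorate (fun ω : (p × p) ⊕ (p × p) => J (Sum.elim id id ω))
              (fun ω u => Sum.elim (fun ω => (1 / 2 : ℂ) • rawEntryTerm Δ₀ ω u)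
                (fun ω => (1 / 2 : ℂ) • (rawEntryTerm Δ₀ ω u)ᵀ) ω) σ u *
            C.map (algebraMap ℝ ℂ)) X R
          (ε - η - μ - μ) (kap - μ - μ)
          ((mF * B6.c0 1 μ ^ ν) * ((mF * B6.c0 1 μ ^ ν) * Real.exp ((ρ - η) * rC) *
            (Real.exp (c.κ₁ * (2 * c₀ : ℕ)) * (B * (mF * mF + 1))) * B6.c0 1 μ ^ ν) *
            Real.exp ((ρ - η - μ) * rC) * B6.c0 1 μ ^ ν) T' SX' A' D' ρ' ∧
        (∀ ω σ u, T' ω σ u = (∏ j ∈ J' ω, σ j) • T0' ω u) ∧ (∀ ω σ u i j, T' (rev' ω) σ u i j = T' ω σ u j i) := by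
  have hM₁ := hG.M₁_pos
  have hε : 0 ≤ ε := hη.le.trans hηε
  have hρ : 0 < ρ := lt_of_le_of_lt hε hρε
  have h₀ := jointWalkExpansion_rawEntrywise (d := d) (N' := N') c hX hL hρε hκε (offLen_nonneg hρε hM₁)
    (card_le_offLen (J := J) hρε hM₁) hfib
  exact structuredExpansion_sandwich_sDecorate_symm hκ₁ h₀
    (fun ω => domBy_entryDist (offLen_nonneg hρε hM₁) ω) J (m₀ := 2 * c₀) (dM := ρ * M₁ / 2)
    (η := η) (by positivity) hη.le hηε (dichotomy_entrywise hX hG hρε hε) (by nlinarith)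
    (fun ω hne => through_entryDist (offLen_nonneg hρε hM₁) (hG.through ω.1 ω.2 hne))
    C hCle hCsupp hfib hμ hμε hμκ (by linarith) (mul_nonneg hL.B_nonneg (by positivity))

omit [NormedAddCommGroup E] [NormedSpace ℂ E] in
/-- **T-56.9 — THE TWO CONSTRUCTIONS AGREE**: for a symmetric decoration, module 25's conditioned operator on the raw
packaging (the decorated symmetrization) IS §4's Hadamard-conditioned operator
`(∏_{□ ∈ J(a,b)} s(□))·½(Δ₀(u)_{ab} + Δ₀(u)_{ba})` — entry by entry, for every `(s,u)`.
[cite: Balaban1988RG2Cluster, p.3 (after (1.7)), p.15] -/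
theorem sDecorate_symmetrize_rawEntryTerm (J : p × p → Finset (TPt d N')) (hJ : ∀ i j, J (j, i) = J (i, j))
    (Δ₀ : E → Matrix p p ℂ) (σ : TPt d N' → ℂ) (u : E) (a b : p) :
    sDecorate (fun ω : (p × p) ⊕ (p × p) => J (Sum.elim id id ω))
        (fun ω u => Sum.elim (fun ω => (1 / 2 : ℂ) • rawEntryTerm Δ₀ ω u)
          (fun ω => (1 / 2 : ℂ) • (rawEntryTerm Δ₀ ω u)ᵀ) ω) σ u a b =
      sDecorate J (entryTerm Δ₀) σ u a b := by
  rw [sDecorate_entryTerm_apply, sDecorate_apply, tsum_fintype, Fintype.sum_sum_type]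
  have hl : ∑ ω : p × p, sTerm (fun ω : (p × p) ⊕ (p × p) => J (Sum.elim id id ω))
      (fun ω u => Sum.elim (fun ω => (1 / 2 : ℂ) • rawEntryTerm Δ₀ ω u)
        (fun ω => (1 / 2 : ℂ) • (rawEntryTerm Δ₀ ω u)ᵀ) ω) (Sum.inl ω) σ u a b =
      (∏ k ∈ J (a, b), σ k) * ((1 / 2 : ℂ) * Δ₀ u a b) := by
    rw [Finset.sum_eq_single (a, b)]
    · rw [sTerm_apply]
      simp only [Sum.elim_inl, id, Matrix.smul_apply, smul_eq_mul]
      rw [show rawEntryTerm Δ₀ (a, b) u a b = Δ₀ u a b from if_pos ⟨rfl, rfl⟩]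
    · intro ω _ hω
      rw [sTerm_apply]
      simp only [Sum.elim_inl, id, Matrix.smul_apply, smul_eq_mul]
      rw [rawEntryTerm_of_ne fun h' => hω (Prod.ext h'.1.symm h'.2.symm), mul_zero, mul_zero]
    · intro h
      exact absurd (Finset.mem_univ _) h
  have hr : ∑ ω : p × p, sTerm (fun ω : (p × p) ⊕ (p × p) => J (Sum.elim id id ω))
      (fun ω u => Sum.elim (fun ω => (1 / 2 : ℂ) • rawEntryTerm Δ₀ ω u)
        (fun ω => (1 / 2 : ℂ) • (rawEntryTerm Δ₀ ω u)ᵀ) ω) (Sum.inr ω) σ u a b =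
      (∏ k ∈ J (a, b), σ k) * ((1 / 2 : ℂ) * Δ₀ u b a) := by
    rw [Finset.sum_eq_single (b, a)]
    · rw [sTerm_apply]
      simp only [Sum.elim_inr, id, Matrix.smul_apply, Matrix.transpose_apply, smul_eq_mul]
      rw [show rawEntryTerm Δ₀ (b, a) u b a = Δ₀ u b a from if_pos ⟨rfl, rfl⟩, hJ a b]
    · intro ω _ hω
      rw [sTerm_apply]
      simp only [Sum.elim_inr, id, Matrix.smul_apply, Matrix.transpose_apply, smul_eq_mul]
      rw [rawEntryTerm_of_ne fun h' => hω (Prod.ext h'.1.symm h'.2.symm), mul_zero, mul_zero]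
    · intro h
      exact absurd (Finset.mem_univ _) h
  rw [hl, hr]
  ring

end Raw

end Literature.MathematicalPhysics.QuantumFieldTheory.Balaban1983to89.B13EntrywiseWalks

end
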